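import Summits.NavierStokesRegularity.FluidComputer.ClayBlowupRows
import Literature.Analysis.FluidPDE.NSForcedLeraySupWindow
import HarnessLib

/-!
# LERAY'S `L^∞` RATE WITH THE CLAY FORCE: `‖u(t)‖_∞ ≥ √(c ν/(T − t)) − (T − t)·sup|P f|` at EVERY
# instant of EVERY Clay blow-up (the (C) type)

Cell `ns-blowup`, seat `ns-blowup-ecbridge-2` (g9; the E–C endpoint theory seat). LABEL: E–C typing
(KERNEL — no named fact). WHAT THIS IS NOT: not Navier–Stokes evidence — necessary conditions on the
TYPE `ClayBlowup ν` (no inhabitant is claimed anywhere), hence — by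
`navierStokesBreakdownR3_iff_exists_nonempty_clayBlowup` — on every breakdown scenario for Fefferman's
(C). Companion memo: `run/shared/lean/pub/ns-blowup/ecbridge2/ECBRIDGE-2-MEMO-8.md`.

## Content

g8's `ClayBlowupLerayRate.lean` proved Leray's sup-norm clock `c√ν/√(T−t) ≤ ‖u(t)‖_∞` at every
instant only for the UNFORCED inhabitants (`leray_rate_sup`, via pub-fluidc's `LeraySupClock` on the
maximal Leray–Hopf completion), and `ClayBlowupForcedLerayRate.lean` the forced rate only in `L^q`,
`3 < q < ∞`, in liminf form. The Literature file `NSForcedLeraySupWindow` (Leray's `L^∞` window WITH a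
force: `‖u‖ ≤ 2(A + T G)` while `(A + T G)² t ≤ c ν`) closes the `L^∞` endpoint WITH the Clay force:
for EVERY `X : ClayBlowup ν`, `ν > 0`, with `F = sup |P f|` the sup of the Leray projection of its
Clay force on `[0, T] × ℝ³` and a universal `c > 0`,

* `ClayBlowup.forced_sup_window` — from any base time `t₀ < T` with `‖u(t₀, ·)‖ ≤ A`, `‖u(t, x)‖ ≤
  2 (A + (T − t₀) F)` for `t₀ ≤ t < T` while `(A + (T − t₀) F)² (t − t₀) ≤ c ν` (re-gauge to `P f`,
  time shift, the window on `[t₀, t]`);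
* **`ClayBlowup.forced_leray_lifespan`** — `c ν < (A + (T − t₀) F)² (T − t₀)`: Leray's (3.16) WITH the
  Clay force (otherwise `u` would be bounded on `[0, T)`, against `velocity_unbounded`);
* **`ClayBlowup.forced_leray_rate_sup`** — `√(c ν/(T − t)) − (T − t) F ≤ ‖u(t)‖_{L^∞}` for EVERY
  `t ∈ [0, T)`: the force shifts Leray's clock by an amount that VANISHES at the blow-up time;
* `DesignedBlowup` twins and the (C)-reading `breakdownR3_leray_sup`.

References: J. Leray, Acta Math. 63 (1934), §19 (3.4)–(3.8), §21 (3.15)–(3.16) [cite: Leray1934, (3.16)];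
P. G. Lemarié-Rieusset (2016), Thm. 6.1 (6.12), Thm. 11.2 [cite: LemarieRieusset2016, Thm. 6.1 (6.12)];
T. Tao, Anal. PDE 6 (2013), (8), Cor. 11.1 [cite: Tao2011, Cor. 11.1]; C. L. Fefferman, Clay problem
description, (C) [cite: FeffermanClay2006, (C)].
-/

noncomputable section

namespace Summit.NavierStokesRegularity.FluidComputer

open Set MeasureTheory Filter Topology Function
open scoped ENNReal ContDiff NNReal
open Literature.Analysis.FluidPDE
open Summit.NavierStokesRegularity.NavierStokesRegularity

namespace ClayBlowup

variable {ν : ℝ} (X : ClayBlowup ν)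

/-! ## §1 The Clay force on the closed slab `[0, T]` -/

/-- The Clay force is jointly smooth on `[0, T] × ℝ³` (it is smooth THROUGH `T`). [cite: FeffermanClay2006, (6)] -/
theorem force_isSmoothSpaceTimeOn_Icc : IsSmoothSpaceTimeOn (Icc 0 X.T) X.f :=
  X.force_smooth.isSmoothSpaceTimeOn_Icc X.T

/-- The Clay force has uniform rapid spatial decay on `[0, T]`. [cite: FeffermanClay2006, (5)] -/
theorem force_hasUniformRapidDecayOn_Icc : HasUniformRapidDecayOn (Icc 0 X.T) X.f :=
  X.force_decay.hasUniformRapidDecayOn_Icc X.force_smooth X.T_pos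

/-! ## §2 The forced `L^∞` window from any base time -/

set_option maxHeartbeats 800000 in
/-- **THE FORCED `L^∞` WINDOW ON THE TYPE, FROM ANY BASE TIME** (`ν > 0`; no named fact): there are a
universal `c > 0` and `F ≥ 0` (the sup of the Leray projection `P f` of the Clay force on `[0, T] × ℝ³`)
such that for every `t₀ ∈ [0, T)`, every `A > 0` with `‖u(t₀, ·)‖ ≤ A`, and every `t ∈ [t₀, T)` with
`(A + (T − t₀) F)² (t − t₀) ≤ c ν`: `‖u(t, x)‖ ≤ 2 (A + (T − t₀) F)` for all `x`. The Literature window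
`leray_sup_window_forced` on the shifted slab `[t₀, t]`, after re-gauging the Clay force to `P f`
(`to_clayProjForce_of_le`); the type supplies finite energy and a qualitative bound on `[0, t]`.
[cite: Leray1934, §19 (3.4)–(3.8), §21 (3.15)] [cite: Tao2011, Cor. 11.1] -/
theorem forced_sup_window (hν : 0 < ν) :
    ∃ c : ℝ, 0 < c ∧ ∃ F : ℝ, 0 ≤ F ∧ ∀ t₀ ∈ Ico 0 X.T, ∀ A : ℝ, 0 < A →
      (∀ x, ‖X.u t₀ x‖ ≤ A) → ∀ t ∈ Ico t₀ X.T, (A + (X.T - t₀) * F) ^ 2 * (t - t₀) ≤ c * ν →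
        ∀ x, ‖X.u t x‖ ≤ 2 * (A + (X.T - t₀) * F) := by
  obtain ⟨c, hc, hwin⟩ := leray_sup_window_forced
  have hT := X.T_pos
  have hfs := X.force_isSmoothSpaceTimeOn_Icc
  have hfd := X.force_hasUniformRapidDecayOn_Icc
  obtain ⟨G, hG0, hG⟩ := exists_norm_clayProjForce_le hT hfs hfd
  have hgc := continuous_uncurry_clayProjForce hT hfs hfd
  obtain ⟨G₂, hG₂, hg2⟩ := exists_eLpNorm_two_clayProjForce_le hT hfs hfd
  refine ⟨c, hc, G, hG0, ?_⟩
  intro t₀ ht₀ A hA0 hA t ht htc x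
  rcases ht.1.eq_or_lt with heq | ht₀t
  · rw [← heq]
    have : 0 ≤ (X.T - t₀) * G := mul_nonneg (by linarith [ht₀.2]) hG0
    linarith [hA x]
  have ht0 : 0 < t := lt_of_le_of_lt ht₀.1 ht₀t
  have htT : t < X.T := ht.2
  have hT' : 0 < t - t₀ := by linarith
  -- the solution on `[0, t]`, driven by the projected force `g = P f` (some pressure `q`)
  obtain ⟨q, hre⟩ : ∃ q : ℝ → EuclideanSpace ℝ (Fin 3) → ℝ,
      IsClassicalNSSolutionOn (Icc 0 t) ν (clayProjForce hT hfs hfd) X.u q :=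
    ⟨_, (X.classical_Icc ht0 htT).to_clayProjForce_of_le hT hfs hfd htT.le⟩
  -- shift the base time to `t₀`
  have hsubI : ∀ τ ∈ Icc 0 (t - t₀), τ + t₀ ∈ Icc 0 t := fun τ hτ =>
    ⟨by linarith [hτ.1, ht₀.1], by linarith [hτ.2]⟩
  have hcl'' : IsClassicalNSSolutionOn (Icc 0 (t - t₀)) ν (fun τ => clayProjForce hT hfs hfd (τ + t₀))
      (fun τ => X.u (τ + t₀)) (fun τ => q (τ + t₀)) :=
    (hre.comp_add_right t₀).mono (fun τ hτ => hsubI τ hτ) (uniqueDiffOn_Icc hT')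
  have hshift : ∀ φ : ℝ → EuclideanSpace ℝ (Fin 3) → EuclideanSpace ℝ (Fin 3),
      Continuous (uncurry φ) → Continuous (uncurry fun τ => φ (τ + t₀)) := fun φ hφ =>
    hφ.comp ((continuous_fst.add continuous_const).prodMk continuous_snd)
  have hg''c := hshift _ hgc
  have hG'' : ∀ τ ∈ Icc 0 (t - t₀), ∀ y, ‖(fun τ => clayProjForce hT hfs hfd (τ + t₀)) τ y‖ ≤ G :=
    fun τ _ y => hG (τ + t₀) y
  have hg''div : ∀ τ ∈ Icc 0 (t - t₀), IsWeaklyDivFree ((fun τ => clayProjForce hT hfs hfd (τ + t₀)) τ) :=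
    fun τ _ => isWeaklyDivFree_clayProjForce hT hfs hfd (τ + t₀)
  have hg''2 : ∀ τ ∈ Icc 0 (t - t₀),
      eLpNorm ((fun τ => clayProjForce hT hfs hfd (τ + t₀)) τ) 2 volume ≤ G₂ :=
    fun τ _ => hg2 (τ + t₀)
  have hE'' : ∃ C : ℝ≥0∞, C < ⊤ ∧ ∀ τ ∈ Icc 0 (t - t₀), ∫⁻ y, ‖(fun τ => X.u (τ + t₀)) τ y‖ₑ ^ 2 ≤ C := by
    obtain ⟨C, hC, hb⟩ := X.energy t htT
    exact ⟨C, hC, fun τ hτ => hb (τ + t₀) (hsubI τ hτ)⟩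
  obtain ⟨B, hB⟩ := X.exists_norm_le hν htT
  have hbd'' : ∀ τ ∈ Icc 0 (t - t₀), ∀ y, ‖(fun τ => X.u (τ + t₀)) τ y‖ ≤ B := fun τ hτ y =>
    hB (τ + t₀) (hsubI τ hτ) y
  have hA' : ∀ y, ‖(fun τ => X.u (τ + t₀)) 0 y‖ ≤ A := fun y => by
    show ‖X.u (0 + t₀) y‖ ≤ A
    rw [zero_add]; exact hA y
  -- the window condition on the shifted slab of length `t − t₀ ≤ T − t₀`
  have hK : A + (t - t₀) * G ≤ A + (X.T - t₀) * G := by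
    have : (t - t₀) * G ≤ (X.T - t₀) * G := mul_le_mul_of_nonneg_right (by linarith) hG0
    linarith
  have hK0 : 0 ≤ A + (t - t₀) * G := by positivity
  have htc' : (A + (t - t₀) * G) ^ 2 * (t - t₀) ≤ c * ν :=
    le_trans (mul_le_mul_of_nonneg_right (pow_le_pow_left₀ hK0 hK 2) hT'.le) htc
  have key := hwin hν hT' hcl'' hg''c hG0 hG'' hg''div hG₂ hg''2 hE'' hbd'' hA0 hA' (t - t₀)
    ⟨hT'.le, le_rfl⟩ htc' x
  have hts : t - t₀ + t₀ = t := by ring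
  have key' : ‖X.u t x‖ ≤ 2 * (A + (t - t₀) * G) := by
    have h := key
    rw [hts] at h
    exact h
  linarith

/-! ## §3 Leray's lifespan bound and `L^∞` rate with the Clay force -/

/-- **LERAY'S LIFESPAN BOUND WITH THE CLAY FORCE, FOR EVERY CLAY BLOW-UP** (`ν > 0`; no named fact):
with the universal `c > 0` and `F = sup |P f| ≥ 0` of `forced_sup_window`, for every `t₀ ∈ [0, T)` and
every `A > 0` bounding `‖u(t₀, ·)‖`: `c ν < (A + (T − t₀) F)² (T − t₀)` — otherwise the window would reach
`T` and `u` would be bounded on `[0, T) × ℝ³` (`velocity_unbounded`). Leray 1934, (3.16), forced.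
[cite: Leray1934, (3.16)] [cite: LemarieRieusset2016, Thm. 6.1 (6.12)] -/
theorem forced_leray_lifespan (hν : 0 < ν) :
    ∃ c : ℝ, 0 < c ∧ ∃ F : ℝ, 0 ≤ F ∧ ∀ t₀ ∈ Ico 0 X.T, ∀ A : ℝ, 0 < A →
      (∀ x, ‖X.u t₀ x‖ ≤ A) → c * ν < (A + (X.T - t₀) * F) ^ 2 * (X.T - t₀) := by
  obtain ⟨c, hc, F, hF0, hwin⟩ := X.forced_sup_window hν
  refine ⟨c, hc, F, hF0, fun t₀ ht₀ A hA0 hA => ?_⟩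
  by_contra hle
  rw [not_lt] at hle
  -- `u` is bounded by `2(A + (T − t₀)F)` on `[t₀, T)`
  have hlate : ∀ t ∈ Ico t₀ X.T, ∀ x, ‖X.u t x‖ ≤ 2 * (A + (X.T - t₀) * F) := by
    intro t ht x
    refine hwin t₀ ht₀ A hA0 hA t ht (le_trans ?_ hle) x
    exact mul_le_mul_of_nonneg_left (by linarith [ht.2]) (sq_nonneg _)
  -- and by some `B₀` on `[0, t₀]`
  have hearly : ∃ B₀ : ℝ, ∀ t ∈ Icc 0 t₀, ∀ x, ‖X.u t x‖ ≤ B₀ := by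
    rcases ht₀.1.eq_or_lt with h0 | ht₀0
    · refine ⟨A, fun t ht x => ?_⟩
      have : t = t₀ := le_antisymm ht.2 (h0 ▸ ht.1)
      rw [this]; exact hA x
    · exact X.exists_norm_le hν ht₀.2
  obtain ⟨B₀, hB₀⟩ := hearly
  refine X.velocity_unbounded hν ⟨max B₀ (2 * (A + (X.T - t₀) * F)), fun t ht x => ?_⟩
  rcases le_or_gt t t₀ with h | h
  · exact (hB₀ t ⟨ht.1, h⟩ x).trans (le_max_left _ _)
  · exact (hlate t ⟨h.le, ht.2⟩ x).trans (le_max_right _ _)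

/-- **LERAY'S `L^∞` RATE WITH THE CLAY FORCE, AT EVERY INSTANT OF EVERY CLAY BLOW-UP** (`ν > 0`; no
named fact): with a universal `c > 0` and `F = sup |P f| ≥ 0`,
`√(c ν / (T − t)) − (T − t) F ≤ ‖u(t)‖_{L^∞}` for every `t ∈ [0, T)` — the Clay force delays Leray's
clock `√(cν/(T−t))` by at most `(T − t)·sup|P f|`, which vanishes at the blow-up time. Supersedes, up to
the constant, the unforced row `leray_rate_sup` of `ClayBlowupLerayRate`.
[cite: Leray1934, (3.16)] [cite: LemarieRieusset2016, Thm. 6.1 (6.12)] -/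
theorem forced_leray_rate_sup (hν : 0 < ν) :
    ∃ c : ℝ, 0 < c ∧ ∃ F : ℝ, 0 ≤ F ∧ ∀ t ∈ Ico 0 X.T,
      ENNReal.ofReal (Real.sqrt (c * ν / (X.T - t)) - (X.T - t) * F) ≤ eLpNorm (X.u t) ⊤ volume := by
  obtain ⟨c, hc, F, hF0, hlife⟩ := X.forced_leray_lifespan hν
  refine ⟨c, hc, F, hF0, fun t ht => ?_⟩
  set N : ℝ≥0∞ := eLpNorm (X.u t) ⊤ volume with hN
  rcases eq_or_ne N ⊤ with hNtop | hNtop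
  · rw [hNtop]; exact le_top
  set D : ℝ := X.T - t with hD
  have hD0 : 0 < D := by rw [hD]; linarith [ht.2]
  set A₀ : ℝ := N.toReal with hA₀
  have hA₀0 : 0 ≤ A₀ := ENNReal.toReal_nonneg
  -- the slice is bounded by `A₀` everywhere (continuity)
  have hcont : Continuous (X.u t) := (X.classical.contDiff_velocity ht).continuous
  have hae : ∀ᵐ x ∂(volume : Measure (EuclideanSpace ℝ (Fin 3))), ‖X.u t x‖ ≤ A₀ := by
    filter_upwards [ae_le_eLpNormEssSup (f := X.u t) (μ := volume)] with x hx
    rw [← eLpNorm_exponent_top] at hx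
    have hx' : ENNReal.ofReal ‖X.u t x‖ ≤ N := by rwa [ofReal_norm]
    exact (ENNReal.ofReal_le_iff_le_toReal hNtop).1 hx'
  have hbd : ∀ x, ‖X.u t x‖ ≤ A₀ := forall_norm_le_of_ae_norm_le hcont hae
  -- `c ν ≤ (A₀ + D F)² D` by letting `A ↓ A₀`
  set K₀ : ℝ := A₀ + D * F with hK₀
  have hK₀0 : 0 ≤ K₀ := by positivity
  have hcν : c * ν ≤ K₀ ^ 2 * D := by
    by_contra hlt
    rw [not_le] at hlt
    -- continuity of `ε ↦ (K₀ + ε)² D` at `0`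
    have hct : ContinuousAt (fun ε : ℝ => (K₀ + ε) ^ 2 * D) 0 :=
      (((continuous_const.add continuous_id).pow 2).mul continuous_const).continuousAt
    have hev : ∀ᶠ ε in 𝓝 (0 : ℝ), (K₀ + ε) ^ 2 * D < c * ν := by
      have h0 : (fun ε : ℝ => (K₀ + ε) ^ 2 * D) 0 < c * ν := by simpa using hlt
      exact hct.eventually (gt_mem_nhds h0)
    have hev' : ∀ᶠ ε in 𝓝[>] (0 : ℝ), (K₀ + ε) ^ 2 * D < c * ν ∧ ε ∈ Ioi (0 : ℝ) :=
      (hev.filter_mono nhdsWithin_le_nhds).and eventually_mem_nhdsWithin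
    obtain ⟨ε, hε, hεpos⟩ := hev'.exists
    have h1 := hlife t ht (A₀ + ε) (by linarith [mem_Ioi.1 hεpos]) fun x => (hbd x).trans (by
      linarith [mem_Ioi.1 hεpos])
    have : (A₀ + ε + (X.T - t) * F) ^ 2 * (X.T - t) = (K₀ + ε) ^ 2 * D := by
      rw [hK₀, hD]; ring
    rw [this] at h1
    exact absurd h1 (not_lt.2 hε.le)
  -- hence `√(c ν / D) ≤ K₀` and the claim
  have hsq : Real.sqrt (c * ν / D) ≤ K₀ := by
    rw [Real.sqrt_le_left hK₀0, div_le_iff₀ hD0]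
    exact hcν
  have hfin : Real.sqrt (c * ν / D) - D * F ≤ A₀ := by rw [hK₀] at hsq; linarith
  calc ENNReal.ofReal (Real.sqrt (c * ν / (X.T - t)) - (X.T - t) * F)
      ≤ ENNReal.ofReal A₀ := ENNReal.ofReal_le_ofReal hfin
    _ = N := ENNReal.ofReal_toReal hNtop

end ClayBlowup

/-! ## §4 The strong type and the Clay statement -/

namespace DesignedBlowup

variable {ν : ℝ} (D : DesignedBlowup ν)

/-- **Leray's lifespan bound with the Clay force for every designed blow-up.** [cite: Leray1934, (3.16)] -/
theorem forced_leray_lifespan (hν : 0 < ν) :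
    ∃ c : ℝ, 0 < c ∧ ∃ F : ℝ, 0 ≤ F ∧ ∀ t₀ ∈ Ico 0 D.T, ∀ A : ℝ, 0 < A →
      (∀ x, ‖D.u t₀ x‖ ≤ A) → c * ν < (A + (D.T - t₀) * F) ^ 2 * (D.T - t₀) :=
  D.toClayBlowup.forced_leray_lifespan hν

/-- **Leray's `L^∞` rate with the Clay force for every designed blow-up.** [cite: Leray1934, (3.16)] -/
theorem forced_leray_rate_sup (hν : 0 < ν) :
    ∃ c : ℝ, 0 < c ∧ ∃ F : ℝ, 0 ≤ F ∧ ∀ t ∈ Ico 0 D.T,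
      ENNReal.ofReal (Real.sqrt (c * ν / (D.T - t)) - (D.T - t) * F) ≤ eLpNorm (D.u t) ⊤ volume :=
  D.toClayBlowup.forced_leray_rate_sup hν

end DesignedBlowup

/-- **EVERY BREAKDOWN SCENARIO FOR (C) RUNS ON LERAY'S `L^∞` CLOCK** (no named fact): if Fefferman's (C)
holds then at every `ν > 0` there is a Clay blow-up — a classical finite-energy forced evolution of a
Clay datum under a Clay force with finite lifespan `T` — with `‖u(t)‖_∞ ≥ √(cν/(T−t)) − (T−t)F` at every
`t < T` (`c > 0` universal, `F ≥ 0` the sup of the projected force). [cite: FeffermanClay2006, (C)]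
[cite: Leray1934, (3.16)] -/
theorem breakdownR3_leray_sup
    (h : Summit.NavierStokesRegularity.NavierStokesRegularity.NavierStokesBreakdownR3)
    {ν : ℝ} (hν : 0 < ν) :
    ∃ X : ClayBlowup ν, ∃ c : ℝ, 0 < c ∧ ∃ F : ℝ, 0 ≤ F ∧ ∀ t ∈ Ico 0 X.T,
      ENNReal.ofReal (Real.sqrt (c * ν / (X.T - t)) - (X.T - t) * F) ≤ eLpNorm (X.u t) ⊤ volume := by
  obtain ⟨X⟩ := forall_nonempty_clayBlowup_of_breakdownR3 h ν hν
  exact ⟨X, X.forced_leray_rate_sup hν⟩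

/-! ## §5 Leray's clock near the blow-up time, clean form (appended, g9) -/

namespace ClayBlowup

variable {ν : ℝ} (X : ClayBlowup ν)

/-- **LERAY'S `L^∞` CLOCK NEAR THE BLOW-UP TIME, WITH THE CLAY FORCE, IN CLEAN FORM** (`ν > 0`; no
named fact): there are a universal-up-to-`1/4` constant `c > 0` and a time `t₁ < T` such that
`√(c ν / (T − t)) ≤ ‖u(t)‖_{L^∞}` for every `t ∈ [0, T)` with `t ≥ t₁` — on the final stretch
`T − t ≤ min(1, c₀ν/(4(F² + 1)))` the force correction `(T − t) F` of `forced_leray_rate_sup` is at most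
half of Leray's clock, so the forced blow-up runs on the unforced clock with `c = c₀/4`.
[cite: Leray1934, (3.16)] [cite: LemarieRieusset2016, Thm. 6.1 (6.12)] -/
theorem forced_leray_rate_sup_near (hν : 0 < ν) :
    ∃ c : ℝ, 0 < c ∧ ∃ t₁ : ℝ, t₁ < X.T ∧ ∀ t ∈ Ico 0 X.T, t₁ ≤ t →
      ENNReal.ofReal (Real.sqrt (c * ν / (X.T - t))) ≤ eLpNorm (X.u t) ⊤ volume := by
  obtain ⟨c, hc, F, hF0, hrate⟩ := X.forced_leray_rate_sup hν
  set δ : ℝ := min 1 (c * ν / (4 * (F ^ 2 + 1))) with hδ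
  have hδpos : 0 < δ := lt_min one_pos (by positivity)
  refine ⟨c / 4, by positivity, X.T - δ, by linarith, fun t ht ht₁ => ?_⟩
  set D : ℝ := X.T - t with hD
  have hD0 : 0 < D := by rw [hD]; linarith [ht.2]
  have hDδ : D ≤ δ := by rw [hD]; linarith
  have hD1 : D ≤ 1 := hDδ.trans (min_le_left _ _)
  have hDc : D * (F ^ 2 + 1) ≤ c * ν / 4 := by
    have h1 : D * (F ^ 2 + 1) ≤ δ * (F ^ 2 + 1) := mul_le_mul_of_nonneg_right hDδ (by positivity)
    have h2 : δ * (F ^ 2 + 1) ≤ c * ν / (4 * (F ^ 2 + 1)) * (F ^ 2 + 1) :=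
      mul_le_mul_of_nonneg_right (min_le_right _ _) (by positivity)
    have h3 : c * ν / (4 * (F ^ 2 + 1)) * (F ^ 2 + 1) = c * ν / 4 := by
      field_simp
    linarith
  -- `(D F)² ≤ (c ν / D) / 4`, hence `D F ≤ √(c ν / D) / 2`
  have hsq : (D * F) ^ 2 ≤ c * ν / D / 4 := by
    have hD3 : D ^ 3 * F ^ 2 ≤ c * ν / 4 := by
      have h1 : D ^ 3 ≤ D := by
        have hD2 : D ^ 2 ≤ 1 := by nlinarith
        calc D ^ 3 = D ^ 2 * D := by ring
          _ ≤ 1 * D := mul_le_mul_of_nonneg_right hD2 hD0.le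
          _ = D := one_mul D
      have h2 : D ^ 3 * F ^ 2 ≤ D * F ^ 2 := mul_le_mul_of_nonneg_right h1 (sq_nonneg _)
      nlinarith
    rw [le_div_iff₀ (by norm_num : (0 : ℝ) < 4), le_div_iff₀ hD0]
    nlinarith
  have hs0 : 0 ≤ c * ν / D := by positivity
  have hDF : D * F ≤ Real.sqrt (c * ν / D) / 2 := by
    have h0 : 0 ≤ D * F := by positivity
    have h1 : D * F ≤ Real.sqrt (c * ν / D / 4) := Real.le_sqrt_of_sq_le hsq
    rw [Real.sqrt_div' _ (by norm_num : (0 : ℝ) ≤ 4), show Real.sqrt 4 = 2 by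
      rw [show (4 : ℝ) = 2 ^ 2 by norm_num, Real.sqrt_sq (by norm_num)]] at h1
    exact h1
  have hhalf : Real.sqrt (c / 4 * ν / (X.T - t)) = Real.sqrt (c * ν / D) / 2 := by
    rw [← hD, show c / 4 * ν / D = c * ν / D / 4 by ring, Real.sqrt_div' _ (by norm_num : (0 : ℝ) ≤ 4),
      show Real.sqrt 4 = 2 by rw [show (4 : ℝ) = 2 ^ 2 by norm_num, Real.sqrt_sq (by norm_num)]]
  calc ENNReal.ofReal (Real.sqrt (c / 4 * ν / (X.T - t)))
      ≤ ENNReal.ofReal (Real.sqrt (c * ν / (X.T - t)) - (X.T - t) * F) := by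
        refine ENNReal.ofReal_le_ofReal ?_
        rw [hhalf, ← hD]
        linarith
    _ ≤ eLpNorm (X.u t) ⊤ volume := hrate t ht

end ClayBlowup

end Summit.NavierStokesRegularity.FluidComputer

end
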